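import Literature.AlgebraicGeometry.HodgeTheory.MotivatedClassesDeformationLeaves
import Literature.AlgebraicGeometry.HodgeTheory.MotivatedClassesPointAuxiliary
import Literature.AlgebraicGeometry.HodgeTheory.HardLefschetzNFoldHolds
import Literature.AlgebraicGeometry.HodgeTheory.HypersurfaceLefschetzProofs
import Literature.AlgebraicGeometry.Motives.VarietiesDimensionProofs
import HarnessLib

/-!
# Route HeckePrymWeil — crux `SummitOffWeilSector` (stmt-HodgeConjecture-14374), line
`motivated-anchor-split`, stub `stub_andreSemisimpleLift`: the unconditional instances of André's
semisimple lift (leaf (A3) of the deformation theorem)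

The registered stub `stub_andreSemisimpleLift : Andre1996_exists_motivated_of_motivated_pullback`
(named fact of `HodgeTheory/MotivatedClassesDeformationLeaves`) is leaf (A3) of the tree's
reduction of André's deformation theorem (Y. André, *Pour une théorie inconditionnelle des
motifs*, Publ. Math. IHÉS 83 (1996), Thm. 0.5; `andreDeformation_of_three_leaves`,
`Theorems/HeckePrymWeilSummitOffWeilSectorAndreDeformationLeaves`): for a morphism `j : X ⟶ X̄` of
smooth projective complex varieties (`dim X̄ = m`, `dim X = n`) and a class `Ā ∈ H²ᵖ(X̄(ℂ); ℂ)`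
whose pull-back `j^* Ā` is motivated on `X`, SOME motivated class `Ā'` of `X̄` has the same
pull-back, `j^* Ā' = j^* Ā`. In print (§5.1, p. 25, second paragraph: "Puisque la catégorie des
motifs est abélienne (0.4) […] en fait, `ξ_s` provient d'un cycle motivé sur `X̄`") this is the
semisimplicity of the category of motivated motives, Thm. 0.4 (`j^* : h(X̄)(p) → h(X)(p)` splits
over its image), i.e. §§2–4 of the paper: motivated correspondences compose (Prop. 2.1) and the
`ℚ`-algebra of motivated correspondences is semisimple by the Hodge index theorem. None of this is
in the tree on the real carriers `complexBetti`: `Motives/MotivatedAutPoints` states Thm. 0.4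
(`Andre1996_thm04_completelyReducible`, `Andre1996_thm04_invariantsMotivated`) on ABSTRACT
Betti–Hodge data only, and the proved Hodge index / Hodge–Riemann theorems of the real carriers
(`hodgeIndex_primitiveAlgebraic_holds`, `hardLefschetz_hodgeRiemann_holds`) concern rational
algebraic, resp. rational `(p,p)`, classes of ONE variety, not motivated correspondences.

This file lands, in the stub's binder shape plus one side condition each, the instances of the
stub that hold unconditionally in the tree. They all come from two devices.

* **`Ā' := Ā`** whenever `Ā` is itself motivated on `X̄` (`andreSemisimpleLift_of_mem_motivatedClasses`),
  in particular whenever it is ALGEBRAIC (`andreSemisimpleLift_of_mem_algebraicClasses`: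
  `A(X̄) ⊆ A_mot(X̄)`, André §2.1 remark "il est clair que `A_mot(X)_E` contient `A(X)`", the tree's
  `algebraicClasses_le_motivatedClasses_of_nonempty_hardLefschetzNFold_self` fed with the PROVED hard
  Lefschetz theorem `nonempty_hardLefschetzNFold_holds`). Hence the stub holds in every degree in
  which all of `H²ᵖ(X̄(ℂ); ℂ)` is algebraic (`andreSemisimpleLift_of_algebraicClasses_eq_top`):
  `p = 0`, the top degree `p = m` (every class is a multiple of the class of a point,
  `mem_algebraicClasses_of_degree_top`) and `p > m` (`H²ᵖ(X̄(ℂ); ℂ) = 0`) —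
  `andreSemisimpleLift_of_eq_zero_or_dim_le`; so in EVERY degree for `X̄` a point or a curve
  (`andreSemisimpleLift_of_dim_le_one`), for `X̄ = ℙᴺ` (`andreSemisimpleLift_projectiveSpace`), and
  for every class `Ā = ι^* a` restricted from a projective space
  (`andreSemisimpleLift_of_map_projectiveSpace`, Voisin II Cor. 1.24). The one instance with
  content on the motivated side is **`j` an isomorphism** (`stub_andreSemisimpleLift_of_iso`, the
  registered sub-goal; `andreSemisimpleLift_of_isIso`): `A_mot` is transported by isomorphisms
  (`map_mem_motivatedClasses_iff_of_iso`, `HodgeTheory/MotivatedClassesTransport`), the two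
  dimensions `m`, `n` being forced equal (`schemeDim_eq_holds`).
* **`Ā' := 0`** whenever `j^* Ā = 0` (`andreSemisimpleLift_of_map_eq_zero`): above the top degree of
  `X`, `p > n`, where `H²ᵖ(X(ℂ); ℂ) = 0` (`andreSemisimpleLift_of_dim_lt`), and whenever `j` factors
  through a smooth projective variety of dimension `< p` (`andreSemisimpleLift_of_comp_of_dim_lt`,
  e.g. a constant morphism and `p ≥ 1`).

`andreSemisimpleLift_closedRange` assembles the degree instances: the stub holds outright for
`p = 0 ∨ m ≤ p ∨ n < p`, for every `j`. What remains OPEN of the stub after this file is the range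
`1 ≤ p ≤ min (m - 1, n)` for `j` not an isomorphism, `Ā ∉ A_motᵖ(X̄)_ℂ` and `j^* Ā ≠ 0` — which
contains the case the deformation theorem uses (`j` = a fibre inclusion followed by the open
immersion into a smooth compactification), whose content is André's Thm. 0.4.

No definition and no named fact is introduced.

## References

* [Andre1996Motifs] Y. André, Pour une théorie inconditionnelle des motifs, Publ. Math. IHÉS 83
  (1996): Thm. 0.4 (p. 7), Thm. 0.5 (p. 8), §2.1 Déf. 1 and the remark following it (p. 14),
  §5.1 (p. 25).
* [VoisinHodgeI2002] C. Voisin, Hodge Theory and Complex Algebraic Geometry I (CUP 2002), Thm. 6.25,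
  Rem. 6.27, §11.1.2, §11.3.
* [VoisinHodgeII2003] C. Voisin, Hodge Theory and Complex Algebraic Geometry II (CUP 2003), §1.2.3
  Cor. 1.24 and Rem. 1.26; §10.2.3 proof of Prop. 10.26.
* [HatcherAT2002] A. Hatcher, Algebraic Topology (CUP 2002), §3.3 Thm. 3.26.
* [Hartshorne1977] R. Hartshorne, Algebraic Geometry, GTM 52, II Ex. 3.20 and III.10.
-/

noncomputable section

-- every declaration of this problem lives in `Summit.HodgeConjecture.HodgeConjecture.…` (summit = sub-problem)
set_option linter.dupNamespace false

open CategoryTheory AlgebraicGeometry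
open Literature.AlgebraicGeometry.Motives Literature.AlgebraicGeometry.HodgeTheory
  Literature.AlgebraicTopology.SingularHomology

namespace Summit.HodgeConjecture.HodgeConjecture.Theorems

/-! ### The device `Ā' := Ā`: classes already motivated, or algebraic, on `X̄` -/

/-- **The stub for `Ā` motivated on `X̄`** (the device `Ā' := Ā`): if `Ā ∈ A_motᵖ(X̄)_ℂ` then `Ā`
itself is the required motivated class with pull-back `j^* Ā`. All the unconditional instances
below except the `Ā' := 0` ones are this remark combined with a membership theorem of the tree.
[cite: Andre1996Motifs, §5.1 (p. 25)] -/
theorem andreSemisimpleLift_of_mem_motivatedClasses ⦃m n : ℕ⦄ ⦃Xbar X : SchemeOver ℂ⦄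
    (j : X ⟶ Xbar) (_hXbar : IsSmoothProjective m Xbar) (_hX : IsSmoothProjective n X) (p : ℕ)
    (Ā : complexBetti Xbar (2 * p)) (hĀ : Ā ∈ motivatedClasses m Xbar p)
    (_h : complexBetti.map j (2 * p) Ā ∈ motivatedClasses n X p) :
    ∃ Ā' ∈ motivatedClasses m Xbar p,
      complexBetti.map j (2 * p) Ā' = complexBetti.map j (2 * p) Ā :=
  ⟨Ā, hĀ, rfl⟩

/-- **The stub for `Ā` algebraic on `X̄`**: if `Ā ∈ Nᵖ H²ᵖ(X̄(ℂ); ℂ) = algebraicClasses X̄ p` then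
`Ā` is motivated on `X̄` — "il est clair que `A_mot(X)_E` contient `A(X)`" (André §2.1, remark
following Déf. 1), PROVED on the real carriers under the hard Lefschetz datum of `X̄`
(`algebraicClasses_le_motivatedClasses_of_nonempty_hardLefschetzNFold_self`), which the tree
supplies unconditionally (`nonempty_hardLefschetzNFold_holds`, Voisin I Thm. 6.25) — so `Ā' := Ā`
works. [cite: Andre1996Motifs, §2.1 remark following Déf. 1 (p. 14)]
[cite: VoisinHodgeI2002, Thm. 6.25 and Rem. 6.27] -/
theorem andreSemisimpleLift_of_mem_algebraicClasses ⦃m n : ℕ⦄ ⦃Xbar X : SchemeOver ℂ⦄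
    (j : X ⟶ Xbar) (hXbar : IsSmoothProjective m Xbar) (_hX : IsSmoothProjective n X) (p : ℕ)
    (Ā : complexBetti Xbar (2 * p)) (hĀ : Ā ∈ algebraicClasses Xbar p)
    (_h : complexBetti.map j (2 * p) Ā ∈ motivatedClasses n X p) :
    ∃ Ā' ∈ motivatedClasses m Xbar p,
      complexBetti.map j (2 * p) Ā' = complexBetti.map j (2 * p) Ā :=
  ⟨Ā, algebraicClasses_le_motivatedClasses_of_nonempty_hardLefschetzNFold_self hXbar
    (nonempty_hardLefschetzNFold_holds m Xbar) p hĀ, rfl⟩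

/-- **The stub in a degree where every class of `X̄` is algebraic**: if
`algebraicClasses X̄ p = Nᵖ H²ᵖ(X̄(ℂ); ℂ) = ⊤` (the whole of `H²ᵖ(X̄(ℂ); ℂ)`), the stub holds in
degree `p` for every `j : X ⟶ X̄` and every `Ā` (`andreSemisimpleLift_of_mem_algebraicClasses`).
[cite: Andre1996Motifs, §2.1 remark following Déf. 1 (p. 14)] -/
theorem andreSemisimpleLift_of_algebraicClasses_eq_top ⦃m n : ℕ⦄ ⦃Xbar X : SchemeOver ℂ⦄
    (j : X ⟶ Xbar) (hXbar : IsSmoothProjective m Xbar) (hX : IsSmoothProjective n X) (p : ℕ)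
    (hp : algebraicClasses Xbar p = ⊤) (Ā : complexBetti Xbar (2 * p))
    (h : complexBetti.map j (2 * p) Ā ∈ motivatedClasses n X p) :
    ∃ Ā' ∈ motivatedClasses m Xbar p,
      complexBetti.map j (2 * p) Ā' = complexBetti.map j (2 * p) Ā :=
  andreSemisimpleLift_of_mem_algebraicClasses j hXbar hX p Ā (Submodule.eq_top_iff'.1 hp Ā) h

/-- **The stub in degree `0` and in the degrees `p ≥ dim X̄`**, for every `j : X ⟶ X̄`: there every
class of `H²ᵖ(X̄(ℂ); ℂ)` is algebraic — `N⁰ H⁰ = H⁰` (`algebraicClasses_zero`); in the top degree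
`p = m` every class vanishes off a point (`mem_algebraicClasses_of_degree_top`, Voisin II proof of
Prop. 10.26); and `H²ᵖ(X̄(ℂ); ℂ) = 0` for `p > m` (`X̄(ℂ)` is a closed `2m`-manifold, Hatcher
Thm. 3.26) — assembled in the tree as `algebraicClasses_eq_top_of_eq_zero_or_le`.
[cite: VoisinHodgeII2003, §10.2.3 proof of Prop. 10.26] [cite: VoisinHodgeI2002, §11.1.2 and §11.3]
[cite: HatcherAT2002, §3.3 Thm. 3.26] -/
theorem andreSemisimpleLift_of_eq_zero_or_dim_le ⦃m n : ℕ⦄ ⦃Xbar X : SchemeOver ℂ⦄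
    (j : X ⟶ Xbar) (hXbar : IsSmoothProjective m Xbar) (hX : IsSmoothProjective n X) (p : ℕ)
    (hp : p = 0 ∨ m ≤ p) (Ā : complexBetti Xbar (2 * p))
    (h : complexBetti.map j (2 * p) Ā ∈ motivatedClasses n X p) :
    ∃ Ā' ∈ motivatedClasses m Xbar p,
      complexBetti.map j (2 * p) Ā' = complexBetti.map j (2 * p) Ā :=
  andreSemisimpleLift_of_algebraicClasses_eq_top j hXbar hX p
    (algebraicClasses_eq_top_of_eq_zero_or_le hXbar hp) Ā h

/-- **The stub for `X̄` a point or a curve, in every degree and for every `j : X ⟶ X̄`**: for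
`m = dim X̄ ≤ 1` every degree `p` is `0` or `≥ m` (`andreSemisimpleLift_of_eq_zero_or_dim_le`).
[cite: VoisinHodgeI2002, §11.1.2 and §11.3] -/
theorem andreSemisimpleLift_of_dim_le_one ⦃m n : ℕ⦄ ⦃Xbar X : SchemeOver ℂ⦄
    (j : X ⟶ Xbar) (hXbar : IsSmoothProjective m Xbar) (hX : IsSmoothProjective n X) (hm : m ≤ 1)
    (p : ℕ) (Ā : complexBetti Xbar (2 * p))
    (h : complexBetti.map j (2 * p) Ā ∈ motivatedClasses n X p) :
    ∃ Ā' ∈ motivatedClasses m Xbar p,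
      complexBetti.map j (2 * p) Ā' = complexBetti.map j (2 * p) Ā :=
  andreSemisimpleLift_of_eq_zero_or_dim_le j hXbar hX p (by omega) Ā h

/-- **The stub for classes restricted from a projective space**: for `ι : X̄ ⟶ ℙᴺ` and
`a ∈ H²ᵖ(ℙᴺ(ℂ); ℂ)`, the class `Ā = ι^* a` is algebraic on `X̄` (`map_projectiveSpace_mem_algebraicClasses`:
`H²ᵖ(ℙᴺ) = ℂ · hᵖ` and `hᵖ|_X̄` is the class of a linear section in general position, Voisin II
Cor. 1.24 and Rem. 1.26), so the stub holds for it and every `j : X ⟶ X̄`.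
[cite: VoisinHodgeII2003, §1.2.3 Cor. 1.24 and Rem. 1.26 (PDF p. 62)] -/
theorem andreSemisimpleLift_of_map_projectiveSpace ⦃m n : ℕ⦄ ⦃Xbar X : SchemeOver ℂ⦄
    (j : X ⟶ Xbar) (hXbar : IsSmoothProjective m Xbar) (hX : IsSmoothProjective n X) ⦃N : ℕ⦄
    (ι : Xbar ⟶ projectiveSpace N ℂ) (p : ℕ) (a : complexBetti (projectiveSpace N ℂ) (2 * p))
    (h : complexBetti.map j (2 * p) (complexBetti.map ι (2 * p) a) ∈ motivatedClasses n X p) :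
    ∃ Ā' ∈ motivatedClasses m Xbar p,
      complexBetti.map j (2 * p) Ā' = complexBetti.map j (2 * p) (complexBetti.map ι (2 * p) a) :=
  andreSemisimpleLift_of_mem_algebraicClasses j hXbar hX p _
    (map_projectiveSpace_mem_algebraicClasses hXbar ι p a) h

/-- **The stub for `X̄ = ℙᴺ`, in every degree and for every `j : X ⟶ ℙᴺ`**: every class of
`H²ᵖ(ℙᴺ(ℂ); ℂ)` is algebraic (restriction along the identity,
`algebraicClasses_eq_top_of_surjective_map`; Voisin I §11.1.2: `H^*(ℙᴺ)` is generated by the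
hyperplane class). The dimension witness `m` of the stub's binder is kept arbitrary.
[cite: VoisinHodgeI2002, §11.1.2] [cite: VoisinHodgeII2003, §1.2.3 Cor. 1.24 (PDF p. 62)] -/
theorem andreSemisimpleLift_projectiveSpace ⦃m n N : ℕ⦄ ⦃X : SchemeOver ℂ⦄
    (j : X ⟶ projectiveSpace N ℂ) (hP : IsSmoothProjective m (projectiveSpace N ℂ))
    (hX : IsSmoothProjective n X) (p : ℕ) (Ā : complexBetti (projectiveSpace N ℂ) (2 * p))
    (h : complexBetti.map j (2 * p) Ā ∈ motivatedClasses n X p) :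
    ∃ Ā' ∈ motivatedClasses m (projectiveSpace N ℂ) p,
      complexBetti.map j (2 * p) Ā' = complexBetti.map j (2 * p) Ā :=
  andreSemisimpleLift_of_algebraicClasses_eq_top j hP hX p
    (algebraicClasses_eq_top_of_surjective_map hP (𝟙 _)
      (by rw [complexBetti.map_id]; exact fun c ↦ ⟨c, rfl⟩)) Ā h

/-! ### The device `Ā' := 0`: pull-backs that vanish -/

/-- **The stub for `j^* Ā = 0`** (the device `Ā' := 0`): the zero class is motivated and has the
same (zero) pull-back. [folklore] -/
theorem andreSemisimpleLift_of_map_eq_zero ⦃m n : ℕ⦄ ⦃Xbar X : SchemeOver ℂ⦄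
    (j : X ⟶ Xbar) (_hXbar : IsSmoothProjective m Xbar) (_hX : IsSmoothProjective n X) (p : ℕ)
    (Ā : complexBetti Xbar (2 * p)) (h0 : complexBetti.map j (2 * p) Ā = 0)
    (_h : complexBetti.map j (2 * p) Ā ∈ motivatedClasses n X p) :
    ∃ Ā' ∈ motivatedClasses m Xbar p,
      complexBetti.map j (2 * p) Ā' = complexBetti.map j (2 * p) Ā :=
  ⟨0, Submodule.zero_mem _, by rw [h0, map_zero]⟩

/-- **The stub above the top degree of `X`**, for every `j : X ⟶ X̄`: for `p > n = dim X`,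
`H²ᵖ(X(ℂ); ℂ) = 0` (`X(ℂ)` is a closed `2n`-manifold, Hatcher Thm. 3.26; the tree's
`subsingleton_complexBetti`), so `j^* Ā = 0` and `Ā' := 0` works. (In this range also
`A_motᵖ(X)_ℂ = 0`, `motivatedClasses_eq_bot_of_lt`, so the hypothesis of the stub is automatic.)
[cite: HatcherAT2002, §3.3 Thm. 3.26] -/
theorem andreSemisimpleLift_of_dim_lt ⦃m n : ℕ⦄ ⦃Xbar X : SchemeOver ℂ⦄
    (j : X ⟶ Xbar) (hXbar : IsSmoothProjective m Xbar) (hX : IsSmoothProjective n X) (p : ℕ)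
    (hp : n < p) (Ā : complexBetti Xbar (2 * p))
    (h : complexBetti.map j (2 * p) Ā ∈ motivatedClasses n X p) :
    ∃ Ā' ∈ motivatedClasses m Xbar p,
      complexBetti.map j (2 * p) Ā' = complexBetti.map j (2 * p) Ā :=
  haveI := subsingleton_complexBetti hX (show 2 * n < 2 * p by omega)
  andreSemisimpleLift_of_map_eq_zero j hXbar hX p Ā (Subsingleton.elim _ _) h

/-- **The stub for `j` factoring through a small variety**: if `j = g ≫ f` with `g : X ⟶ W`,
`f : W ⟶ X̄` and `W` smooth projective of dimension `l < p` (e.g. `j` constant, `W` a point, and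
`p ≥ 1`), then `j^* Ā = g^* (f^* Ā)` with `f^* Ā ∈ H²ᵖ(W(ℂ); ℂ) = 0`, so `Ā' := 0` works.
[cite: HatcherAT2002, §3.3 Thm. 3.26] -/
theorem andreSemisimpleLift_of_comp_of_dim_lt ⦃m n : ℕ⦄ ⦃Xbar X : SchemeOver ℂ⦄
    (j : X ⟶ Xbar) (hXbar : IsSmoothProjective m Xbar) (hX : IsSmoothProjective n X)
    ⦃l : ℕ⦄ ⦃W : SchemeOver ℂ⦄ (hW : IsSmoothProjective l W) (g : X ⟶ W) (f : W ⟶ Xbar)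
    (hj : g ≫ f = j) (p : ℕ) (hl : l < p) (Ā : complexBetti Xbar (2 * p))
    (h : complexBetti.map j (2 * p) Ā ∈ motivatedClasses n X p) :
    ∃ Ā' ∈ motivatedClasses m Xbar p,
      complexBetti.map j (2 * p) Ā' = complexBetti.map j (2 * p) Ā := by
  haveI := subsingleton_complexBetti hW (show 2 * l < 2 * p by omega)
  refine andreSemisimpleLift_of_map_eq_zero j hXbar hX p Ā ?_ h
  rw [← hj, complexBetti.map_comp, ModuleCat.comp_apply,
    Subsingleton.elim (complexBetti.map f (2 * p) Ā) 0, map_zero]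

/-! ### Isomorphisms: the registered sub-goal -/

/-- **The stub for `j` an isomorphism `e : X ≅ X̄`** (registered sub-goal of
`stub_andreSemisimpleLift`; the instance with content on the motivated side): motivated classes
are transported by isomorphisms of smooth projective complex varieties —
`e^* Ā ∈ A_motᵖ(X)_ℂ ↔ Ā ∈ A_motᵖ(X̄)_ℂ` (`map_mem_motivatedClasses_iff_of_iso`,
`HodgeTheory/MotivatedClassesTransport`: André's generators `pr_{X*}(α ∪ *_L β)` transport, the
orientations, polarisation and algebraic classes being carried along `e ⊗ Y`) — so `Ā' := Ā`
works. The two dimension witnesses are equal, `m = dim X̄ = dim X = n`, both being the Krull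
dimension of the homeomorphic underlying spaces (`schemeDim_eq_holds`, Hartshorne II Ex. 3.20,
with `IsSmoothProjective.of_iso`). [cite: Andre1996Motifs, §2.1 Déf. 1 (p. 14) and §5.1 (p. 25)]
[cite: Hartshorne1977, II Ex. 3.20 and III.10] -/
theorem stub_andreSemisimpleLift_of_iso :
    ∀ ⦃m n : ℕ⦄ ⦃Xbar X : SchemeOver ℂ⦄ (e : X ≅ Xbar),
      IsSmoothProjective m Xbar → IsSmoothProjective n X →
      ∀ (p : ℕ) (Ā : complexBetti Xbar (2 * p)),
        complexBetti.map e.hom (2 * p) Ā ∈ motivatedClasses n X p →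
        ∃ Ā' ∈ motivatedClasses m Xbar p,
          complexBetti.map e.hom (2 * p) Ā' = complexBetti.map e.hom (2 * p) Ā := by
  intro m n Xbar X e hXbar hX p Ā hĀ
  obtain rfl : m = n :=
    (schemeDim_eq_holds hXbar).symm.trans (schemeDim_eq_holds (IsSmoothProjective.of_iso e hX))
  exact ⟨Ā, (map_mem_motivatedClasses_iff_of_iso hXbar hX e Ā).1 hĀ, rfl⟩

/-- **The stub for `j` an isomorphism**, in the stub's own binder shape with `[IsIso j]`
(`stub_andreSemisimpleLift_of_iso` applied to `asIso j`). [cite: Andre1996Motifs, §2.1 Déf. 1 (p. 14) and §5.1 (p. 25)] -/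
theorem andreSemisimpleLift_of_isIso ⦃m n : ℕ⦄ ⦃Xbar X : SchemeOver ℂ⦄
    (j : X ⟶ Xbar) [IsIso j] (hXbar : IsSmoothProjective m Xbar) (hX : IsSmoothProjective n X)
    (p : ℕ) (Ā : complexBetti Xbar (2 * p))
    (h : complexBetti.map j (2 * p) Ā ∈ motivatedClasses n X p) :
    ∃ Ā' ∈ motivatedClasses m Xbar p,
      complexBetti.map j (2 * p) Ā' = complexBetti.map j (2 * p) Ā :=
  stub_andreSemisimpleLift_of_iso (asIso j) hXbar hX p Ā h

/-! ### Assembly: the closed range of degrees -/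

/-- **The unconditional range of degrees of `stub_andreSemisimpleLift`**: for every morphism
`j : X ⟶ X̄` of smooth projective complex varieties (`dim X̄ = m`, `dim X = n`) the stub holds in
the degrees `p = 0 ∨ m ≤ p ∨ n < p` (`andreSemisimpleLift_of_eq_zero_or_dim_le`,
`andreSemisimpleLift_of_dim_lt`). The complementary range `1 ≤ p ≤ min (m - 1, n)` is where
André's Thm. 0.4 (semisimplicity of motivated motives) is needed.
[cite: Andre1996Motifs, Thm. 0.4 (p. 7) and §5.1 (p. 25)] [cite: VoisinHodgeI2002, §11.1.2 and §11.3]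
[cite: HatcherAT2002, §3.3 Thm. 3.26] -/
theorem andreSemisimpleLift_closedRange ⦃m n : ℕ⦄ ⦃Xbar X : SchemeOver ℂ⦄
    (j : X ⟶ Xbar) (hXbar : IsSmoothProjective m Xbar) (hX : IsSmoothProjective n X) (p : ℕ)
    (hp : p = 0 ∨ m ≤ p ∨ n < p) (Ā : complexBetti Xbar (2 * p))
    (h : complexBetti.map j (2 * p) Ā ∈ motivatedClasses n X p) :
    ∃ Ā' ∈ motivatedClasses m Xbar p,
      complexBetti.map j (2 * p) Ā' = complexBetti.map j (2 * p) Ā := by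
  rcases hp with hp | hp | hp
  · exact andreSemisimpleLift_of_eq_zero_or_dim_le j hXbar hX p (Or.inl hp) Ā h
  · exact andreSemisimpleLift_of_eq_zero_or_dim_le j hXbar hX p (Or.inr hp) Ā h
  · exact andreSemisimpleLift_of_dim_lt j hXbar hX p hp Ā h

end Summit.HodgeConjecture.HodgeConjecture.Theorems

end
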